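import Summits.NavierStokesRegularity.NavierStokesRegularity.Theorems.HighSpeedPressureWork.Negative.ExponentCollapse
import Summits.NavierStokesRegularity.NavierStokesRegularity.Theorems.Target.Negative.NormalForms
import Literature.Analysis.FluidPDE.NormalisedPressureAffine
import Literature.Analysis.FluidPDE.ClassicalSolutionRescale
import Literature.Analysis.FluidPDE.LerayHopfNSRescale
import Literature.Analysis.FluidPDE.NSLerayHopfABCScaling

/-!
# Crux `HighSpeedPressureWork` (stmt-NavierStokesRegularity-18149, route `LevelSetModeration`),
# negative side II: Leray similarity — scaling laws, tightness of the data modulus `F(E₀, B₀)`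

Negative-side (cdisprove, D-0016) structure theorems from `Cruxes/HighSpeedPressureWork/Disproof.lean`
§2 (cycle 1). Along Leray's similarity `u ↦ l u(l²·, l·)` (Leray 1934, §20) the three functionals
of the crux scale EXACTLY (junk branches of `fderiv`, `c/0`, Bochner/`toReal` included):
`pressureWork_nsRescale` (`l⁻¹`), `highSetMeasure_nsRescale` (`l⁻⁵`), `speedDissipation_nsRescale`
(`l⁻¹`); data bounds move to `(E₀/l, l B₀)`, levels to `(lM, lc)`. Consequences:
* `hspwWith_scaling`: for a global classical Leray–Hopf solution and every `l > 0`, `t < l²T`,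
  `PW_c(t) ≤ l^{(m-4)/2} √(F(E₀/l, lB₀) M^m V_c(l²T)) √(D_c(l²T))`;
  `modulus_lower_bound_of_overshoot`: hence `|F(E₀/l, lB₀)| ≥ l^{4-m} PW² /(M^m K²)` along the
  orbit of an overshooting solution — the `2/3` gain over the dimensional `m = 4` can only come
  from the `B₀`-growth of `F` (`F ≳ B₀^{4-m}` at fixed `E₀B₀`; the planner's "extra scale").
* `not_hspwWith_const_of_overshoot` / `not_uniformHighSpeedPressureWork`: the DATA-UNIFORM
  strengthening (`F` constant on a fibre) with any `m < 4` is FALSE modulo `OvershootExists ν`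
  (one global classical Leray–Hopf solution with a positive pressure-work event — a speed
  overshoot above the initial maximum — and bounded `V`, `D`; not constructible in the tree).
Helper: `hasRapidSpatialDecay_nsRescaleData` from `Target/Negative/NormalForms`.
Nothing here closes the item (`--supports`). [cite: Leray1934, §20 (similarity transformation)]
-/

noncomputable section

open MeasureTheory TopologicalSpace Set Function Filter Metric
open scoped Topology RealInnerProductSpace ContDiff InnerProductSpace ENNReal
open Literature.Analysis.FluidPDE
open Summit.NavierStokesRegularity.NavierStokesRegularity.Theses.LevelSetModeration
open Summit.NavierStokesRegularity.NavierStokesRegularity.Theorems.Target.Negative (hasRapidSpatialDecay_nsRescaleData)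

namespace Summit.NavierStokesRegularity.NavierStokesRegularity.Theorems.HighSpeedPressureWork.Negative

/-- Local notation for physical space `ℝ³ = EuclideanSpace ℝ (Fin 3)`. -/
local notation "ℝ³" => EuclideanSpace ℝ (Fin 3)

/-! ## §2 Leray similarity: scaling laws of the three functionals and tightness of the modulus -/

section Scaling

variable {u : ℝ → ℝ³ → ℝ³} {l : ℝ}

-- Change of variables `y ↦ l y` in a Lebesgue integral over `ℝ³` (`l > 0`): the former private
-- `lintegral_comp_smul₃` duplicated `Literature.Analysis.FluidPDE.lintegral_comp_smul_three`
-- (`NSCriticalClosureBesovProofs.lean`, in the import closure, namespace opened) and was removed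
-- (dedup-03068); the one call site below uses the Literature lemma.

/-- The pressure slice of the rescaled field: `p̃[(nsRescale l u) τ] = l² p̃[u(l²τ)] ∘ (l ·)`. -/
theorem normalisedPressure_nsRescale_slice (u : ℝ → ℝ³ → ℝ³) (hl : 0 < l) (τ : ℝ) :
    normalisedPressure (nsRescale l u τ) =
      fun y => l ^ 2 * normalisedPressure (u (l ^ 2 * τ)) (l • y) := by
  funext y
  have h1 : nsRescale l u τ = fun y => l • u (l ^ 2 * τ) (0 + l • y) := by
    funext z; simp
  rw [h1, normalisedPressure_smul_comp_affine (u (l ^ 2 * τ)) 0 l hl y, zero_add]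

/-- The integrand of the pressure work rescales by `l⁴` (slice by slice, pointwise; the junk
branches of `fderiv` and of `c / 0` are covariant). -/
theorem pressureWork_integrand_nsRescale (u : ℝ → ℝ³ → ℝ³) (hl : 0 < l) (c τ : ℝ) :
    (fun y => max (1 - l * c / ‖nsRescale l u τ y‖) 0 *
        (fderiv ℝ (normalisedPressure (nsRescale l u τ)) y (nsRescale l u τ y))) =
      fun y => l ^ 4 * (max (1 - c / ‖u (l ^ 2 * τ) (l • y)‖) 0 *
        (fderiv ℝ (normalisedPressure (u (l ^ 2 * τ))) (l • y) (u (l ^ 2 * τ) (l • y)))) := by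
  have hl0 : l ≠ 0 := hl.ne'
  funext y
  have hW : max (1 - l * c / ‖nsRescale l u τ y‖) 0 = max (1 - c / ‖u (l ^ 2 * τ) (l • y)‖) 0 := by
    rw [nsRescale_apply, norm_smul, Real.norm_eq_abs, abs_of_pos hl, mul_div_mul_left _ _ hl0]
  have hD : fderiv ℝ (normalisedPressure (nsRescale l u τ)) y =
      (l ^ 2 * l) • fderiv ℝ (normalisedPressure (u (l ^ 2 * τ))) (l • y) := by
    rw [normalisedPressure_nsRescale_slice u hl τ,
      show (fun y => l ^ 2 * normalisedPressure (u (l ^ 2 * τ)) (l • y)) =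
        (l ^ 2) • (fun y => normalisedPressure (u (l ^ 2 * τ)) (l • y)) from rfl,
      fderiv_const_smul_field, Pi.smul_apply, fderiv_comp_smul, smul_smul]
  rw [hW, hD, nsRescale_apply, FunLike.coe_smul, Pi.smul_apply, map_smul, smul_eq_mul,
    smul_eq_mul]
  ring

/-- **Scaling law of the pressure work**: `PW[u_l]_{lc}(t/l²) = l⁻¹ PW[u]_c(t)`. -/
theorem pressureWork_nsRescale (u : ℝ → ℝ³ → ℝ³) (hl : 0 < l) (c t : ℝ) :
    pressureWork (nsRescale l u) (l * c) (t / l ^ 2) = l⁻¹ * pressureWork u c t := by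
  have hl0 : l ≠ 0 := hl.ne'
  have hl2 : 0 < l ^ 2 := by positivity
  set g : ℝ → ℝ := fun σ => ∫ x, max (1 - c / ‖u σ x‖) 0 *
    (fderiv ℝ (normalisedPressure (u σ)) x (u σ x)) with hg
  have hI : (fun τ => ∫ y, max (1 - l * c / ‖nsRescale l u τ y‖) 0 *
      (fderiv ℝ (normalisedPressure (nsRescale l u τ)) y (nsRescale l u τ y))) =
      fun τ => l * g (l ^ 2 * τ) := by
    funext τ
    rw [pressureWork_integrand_nsRescale u hl c τ, integral_const_mul,
      Measure.integral_comp_smul volume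
        (fun x => max (1 - c / ‖u (l ^ 2 * τ) x‖) 0 *
          (fderiv ℝ (normalisedPressure (u (l ^ 2 * τ))) x (u (l ^ 2 * τ) x))) l,
      finrank_euclideanSpace_fin, abs_of_nonneg (by positivity), smul_eq_mul, hg]
    field_simp
  unfold pressureWork
  rw [hI, setIntegral_Ioo_comp_const_mul (fun σ => l * g σ) hl2 0 (t / l ^ 2), mul_zero,
    mul_div_cancel₀ t hl2.ne', integral_const_mul, smul_eq_mul, hg]
  field_simp

/-- The super-level set of the rescaled slice is the dilated super-level set. -/
theorem highSet_nsRescale (u : ℝ → ℝ³ → ℝ³) (hl : 0 < l) (c τ : ℝ) :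
    {y : ℝ³ | l * c < ‖nsRescale l u τ y‖} = (fun y => l • y) ⁻¹' {x | c < ‖u (l ^ 2 * τ) x‖} := by
  ext y
  simp only [mem_setOf_eq, mem_preimage, nsRescale_apply, norm_smul, Real.norm_eq_abs,
    abs_of_pos hl]
  exact ⟨fun h => lt_of_mul_lt_mul_left h hl.le, fun h => mul_lt_mul_of_pos_left h hl⟩

/-- **Scaling law of the high-set measure**: `V[u_l]_{lc}(T/l²) = l⁻⁵ V[u]_c(T)`. -/
theorem highSetMeasure_nsRescale (u : ℝ → ℝ³ → ℝ³) (hl : 0 < l) (c T : ℝ) :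
    highSetMeasure (nsRescale l u) (l * c) (T / l ^ 2) = (l ^ 5)⁻¹ * highSetMeasure u c T := by
  have hl0 : l ≠ 0 := hl.ne'
  have hl2 : 0 < l ^ 2 := by positivity
  unfold highSetMeasure
  have hV : (fun τ => volume {y : ℝ³ | l * c < ‖nsRescale l u τ y‖}) =
      fun τ => ENNReal.ofReal ((l ^ 3)⁻¹) * volume {x | c < ‖u (l ^ 2 * τ) x‖} := by
    funext τ
    rw [highSet_nsRescale u hl c τ, Measure.addHaar_preimage_smul volume hl0,
      finrank_euclideanSpace_fin, abs_of_nonneg (by positivity)]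
  rw [hV, lintegral_const_mul' _ _ ENNReal.ofReal_ne_top,
    setLIntegral_Ioo_comp_const_mul (fun σ => volume {x | c < ‖u σ x‖}) hl2 0 (T / l ^ 2),
    mul_zero, mul_div_cancel₀ T hl2.ne', ENNReal.toReal_mul, ENNReal.toReal_mul,
    ENNReal.toReal_ofReal (by positivity), ENNReal.toReal_ofReal (by positivity)]
  field_simp

/-- The speed of the rescaled slice and its gradient. -/
theorem fderiv_speed_nsRescale (u : ℝ → ℝ³ → ℝ³) (hl : 0 < l) (τ : ℝ) (y : ℝ³) :
    ‖fderiv ℝ (fun z => ‖nsRescale l u τ z‖) y‖ ^ 2 =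
      l ^ 4 * ‖fderiv ℝ (fun x => ‖u (l ^ 2 * τ) x‖) (l • y)‖ ^ 2 := by
  set N : ℝ³ → ℝ := fun x => ‖u (l ^ 2 * τ) x‖ with hN
  have h1 : (fun z => ‖nsRescale l u τ z‖) = l • (fun z => N (l • z)) := by
    funext z
    simp [hN, norm_smul, abs_of_pos hl]
  rw [h1, fderiv_const_smul_field, Pi.smul_apply, fderiv_comp_smul, smul_smul, norm_smul,
    Real.norm_eq_abs, abs_of_pos (mul_pos hl hl)]
  ring

/-- **Scaling law of the level-set dissipation**: `D[u_l]_{lc}(T/l²) = l⁻¹ D[u]_c(T)`. -/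
theorem speedDissipation_nsRescale (u : ℝ → ℝ³ → ℝ³) (hl : 0 < l) (c T : ℝ) :
    speedDissipation (nsRescale l u) (l * c) (T / l ^ 2) = l⁻¹ * speedDissipation u c T := by
  have hl0 : l ≠ 0 := hl.ne'
  have hl2 : 0 < l ^ 2 := by positivity
  unfold speedDissipation
  have hS : (fun τ => ∫⁻ y, Set.indicator {y : ℝ³ | l * c < ‖nsRescale l u τ y‖}
      (fun y => ENNReal.ofReal (‖fderiv ℝ (fun z => ‖nsRescale l u τ z‖) y‖ ^ 2)) y) =
      fun τ => ENNReal.ofReal ((l ^ 3)⁻¹) * (ENNReal.ofReal (l ^ 4) *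
        ∫⁻ x, Set.indicator {x | c < ‖u (l ^ 2 * τ) x‖}
          (fun x => ENNReal.ofReal (‖fderiv ℝ (fun z => ‖u (l ^ 2 * τ) z‖) x‖ ^ 2)) x) := by
    funext τ
    have hpt : (fun y => Set.indicator {y : ℝ³ | l * c < ‖nsRescale l u τ y‖}
        (fun y => ENNReal.ofReal (‖fderiv ℝ (fun z => ‖nsRescale l u τ z‖) y‖ ^ 2)) y) =
        fun y => (Set.indicator {x | c < ‖u (l ^ 2 * τ) x‖}
          (fun x => ENNReal.ofReal (l ^ 4) *
            ENNReal.ofReal (‖fderiv ℝ (fun z => ‖u (l ^ 2 * τ) z‖) x‖ ^ 2))) (l • y) := by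
      funext y
      rw [highSet_nsRescale u hl c τ, ← Set.indicator_comp_right (fun y : ℝ³ => l • y)]
      congr 1
      funext z
      simp only [Function.comp_apply]
      rw [fderiv_speed_nsRescale u hl τ z, ENNReal.ofReal_mul (by positivity)]
    rw [hpt, lintegral_comp_smul_three _ hl]
    congr 1
    rw [← lintegral_const_mul' _ _ ENNReal.ofReal_ne_top]
    congr 1
    funext x
    rw [Set.indicator_const_mul]
  rw [hS, lintegral_const_mul' _ _ ENNReal.ofReal_ne_top, lintegral_const_mul' _ _ ENNReal.ofReal_ne_top,
    setLIntegral_Ioo_comp_const_mul (fun σ => ∫⁻ x, Set.indicator {x | c < ‖u σ x‖}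
      (fun x => ENNReal.ofReal (‖fderiv ℝ (fun z => ‖u σ z‖) x‖ ^ 2)) x) hl2 0 (T / l ^ 2),
    mul_zero, mul_div_cancel₀ T hl2.ne', ENNReal.toReal_mul, ENNReal.toReal_mul,
    ENNReal.toReal_mul, ENNReal.toReal_ofReal (by positivity),
    ENNReal.toReal_ofReal (by positivity), ENNReal.toReal_ofReal (by positivity)]
  field_simp

/-- The time set of the rescaled solution: `(l² ·)⁻¹' [0, l²T) = [0, T)`. -/
theorem preimage_mul_Ico (hl : 0 < l) (T : ℝ) :
    (fun t => l ^ 2 * t) ⁻¹' Set.Ico 0 (l ^ 2 * T) = Set.Ico 0 T := by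
  have hl2 : 0 < l ^ 2 := by positivity
  ext s
  simp only [Set.mem_preimage, Set.mem_Ico]
  constructor
  · rintro ⟨h1, h2⟩
    exact ⟨le_of_mul_le_mul_left (by rw [mul_zero]; exact h1) hl2, lt_of_mul_lt_mul_left h2 hl2.le⟩
  · rintro ⟨h1, h2⟩
    exact ⟨mul_nonneg hl2.le h1, mul_lt_mul_of_pos_left h2 hl2⟩

/-- **The crux under Leray's similarity (tightness of the data modulus).** If `HSPWWith ν T m F`
holds and `u` is a GLOBAL classical Leray–Hopf solution from a rapidly decaying datum with bounds
`(E₀, B₀)`, then for every admissible `(M, c)`, `t ≥ 0` and `l > 0` with `t < l² T`, applying the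
crux to `u_l = l u(l²·, l·)` (bounds `(E₀/l, l B₀)`, levels `(lM, lc)`, time `t/l²`) and scaling
back gives `PW_c(t) ≤ l^{(m-4)/2} · √(F(E₀/l, lB₀) M^m V_c(l²T)) · √(D_c(l²T))`: for `m < 4` the
prefactor decays, so the modulus must grow like `l^{4-m}` along the orbit ("with `ν` alone,
`m = 4` is forced", made quantitative). -/
theorem hspwWith_scaling {ν T m : ℝ} {F : ℝ → ℝ → ℝ} (hT : 0 < T) (h : HSPWWith ν T m F)
    {u : ℝ → ℝ³ → ℝ³} {p : ℝ → ℝ³ → ℝ}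
    (hcl : ∀ T', 0 < T' → IsClassicalNSSolutionOn (Set.Ico 0 T') ν 0 u p)
    (hLH : ∀ T', 0 < T' → IsLerayHopfOn T' ν 0 (u 0) u)
    (hdec : HasRapidSpatialDecay (u 0))
    {E₀ B₀ M c t : ℝ} (hE : (∫ x, ‖u 0 x‖ ^ 2) ≤ E₀) (hB : ∀ x, ‖u 0 x‖ ≤ B₀)
    (hM : 2 * B₀ ≤ M) (hMc : M / 2 ≤ c) (hcM : c ≤ M) (hc : 0 < c) (ht : 0 ≤ t)
    (hl : 0 < l) (htl : t < l ^ 2 * T) :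
    pressureWork u c t ≤ l ^ ((m - 4) / 2) *
      (Real.sqrt (F (E₀ / l) (l * B₀) * M ^ m * highSetMeasure u c (l ^ 2 * T)) *
        Real.sqrt (speedDissipation u c (l ^ 2 * T))) := by
  have hl0 : l ≠ 0 := hl.ne'
  have hl2 : 0 < l ^ 2 := by positivity
  have hT2 : 0 < l ^ 2 * T := mul_pos hl2 hT
  -- admissibility of the rescaled solution on the fibre `(ν, T)`
  have hcl' : IsClassicalNSSolutionOn (Set.Ico 0 T) ν 0 (nsRescale l u) (nsRescalePressure l p) := by
    have key := IsClassicalNSSolutionOn.nsRescale_holds (hcl (l ^ 2 * T) hT2) hl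
    rwa [nsRescaleForce_zero, preimage_mul_Ico hl T] at key
  have hLH' : IsLerayHopfOn T ν 0 (nsRescale l u 0) (nsRescale l u) := by
    have key := isLerayHopfOn_nsRescale (hLH (l ^ 2 * T) hT2) hl
    rw [nsRescaleForce_zero, mul_div_cancel_left₀ T hl2.ne'] at key
    rwa [nsRescale_zero_time]
  have hdec' : HasRapidSpatialDecay (nsRescale l u 0) := by
    rw [nsRescale_zero_time]
    exact hasRapidSpatialDecay_nsRescaleData ((hcl T hT).contDiff_velocity ⟨le_rfl, hT⟩) hdec hl
  -- data bounds of the rescaled datum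
  have hE' : (∫ x, ‖nsRescale l u 0 x‖ ^ 2) ≤ E₀ / l := by
    have h1 : (fun x => ‖nsRescale l u 0 x‖ ^ 2) = fun x => l ^ 2 * ‖u 0 (l • x)‖ ^ 2 := by
      funext x
      rw [nsRescale_apply, mul_zero, norm_smul, Real.norm_eq_abs, abs_of_pos hl, mul_pow]
    rw [h1, integral_const_mul, Measure.integral_comp_smul volume (fun z => ‖u 0 z‖ ^ 2) l,
      finrank_euclideanSpace_fin, abs_of_nonneg (by positivity), smul_eq_mul,
      show l ^ 2 * ((l ^ 3)⁻¹ * ∫ z, ‖u 0 z‖ ^ 2) = (∫ z, ‖u 0 z‖ ^ 2) / l by field_simp]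
    exact div_le_div_of_nonneg_right hE hl.le
  have hB' : ∀ x, ‖nsRescale l u 0 x‖ ≤ l * B₀ := fun x => by
    rw [nsRescale_apply, mul_zero, norm_smul, Real.norm_eq_abs, abs_of_pos hl]
    exact mul_le_mul_of_nonneg_left (hB (l • x)) hl.le
  -- the crux applied to the rescaled solution at levels `(lM, lc)` and time `t/l²`
  have h1 := mul_le_mul_of_nonneg_left hM hl.le
  have h2 := mul_le_mul_of_nonneg_left hMc hl.le
  have h3 := mul_le_mul_of_nonneg_left hcM hl.le
  have key := h _ _ hcl' hLH' hdec' (E₀ / l) (l * B₀) hE' hB' (l * M) (l * c) (t / l ^ 2)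
    (by linarith) (by linarith) h3 (mul_pos hl hc)
    ⟨div_nonneg ht hl2.le, (div_lt_iff₀ hl2).2 (by linarith)⟩
  rw [pressureWork_nsRescale u hl c t] at key
  have hV : highSetMeasure (nsRescale l u) (l * c) T = (l ^ 5)⁻¹ * highSetMeasure u c (l ^ 2 * T) := by
    have := highSetMeasure_nsRescale u hl c (l ^ 2 * T)
    rwa [mul_div_cancel_left₀ T hl2.ne'] at this
  have hD : speedDissipation (nsRescale l u) (l * c) T = l⁻¹ * speedDissipation u c (l ^ 2 * T) := by
    have := speedDissipation_nsRescale u hl c (l ^ 2 * T)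
    rwa [mul_div_cancel_left₀ T hl2.ne'] at this
  rw [hV, hD] at key
  -- algebra: collect the powers of `l`
  set V := highSetMeasure u c (l ^ 2 * T) with hVdef
  set D := speedDissipation u c (l ^ 2 * T) with hDdef
  set A := F (E₀ / l) (l * B₀) * M ^ m * V with hA
  have hM0 : 0 ≤ M := le_trans hc.le hcM
  have e1 : F (E₀ / l) (l * B₀) * (l * M) ^ m * ((l ^ 5)⁻¹ * V) = l ^ (m - 5) * A := by
    rw [Real.mul_rpow hl.le hM0, Real.rpow_sub hl, Real.rpow_ofNat, hA]
    field_simp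
  have e2 : Real.sqrt (l ^ (m - 5) * A) * Real.sqrt (l⁻¹ * D) =
      l ^ ((m - 6) / 2) * (Real.sqrt A * Real.sqrt D) := by
    rw [Real.sqrt_mul (Real.rpow_nonneg hl.le _), Real.sqrt_mul (inv_nonneg.2 hl.le),
      Real.sqrt_eq_rpow (l ^ (m - 5)), Real.sqrt_eq_rpow l⁻¹, ← Real.rpow_mul hl.le,
      Real.inv_rpow hl.le, ← Real.rpow_neg hl.le,
      show l ^ ((m - 6) / 2) = l ^ ((m - 5) * (1 / 2)) * l ^ (-(1 / 2 : ℝ)) from by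
        rw [← Real.rpow_add hl]; congr 1; ring]
    ring
  rw [e1, e2] at key
  have e3 : l * l ^ ((m - 6) / 2) = l ^ ((m - 4) / 2) := by
    rw [show (m - 4) / 2 = 1 + (m - 6) / 2 by ring, Real.rpow_add hl, Real.rpow_one]
  calc pressureWork u c t = l * (l⁻¹ * pressureWork u c t) := by field_simp
    _ ≤ l * (l ^ ((m - 6) / 2) * (Real.sqrt A * Real.sqrt D)) :=
        mul_le_mul_of_nonneg_left key hl.le
    _ = l ^ ((m - 4) / 2) * (Real.sqrt A * Real.sqrt D) := by rw [← mul_assoc, e3]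

/-- **An overshooting global solution** for the viscosity `ν`: a classical solution on every
`[0, T')`, Leray–Hopf on every `[0, T']`, from a rapidly decaying datum with bounds `(E₀, B₀)`,
together with an admissible event — levels `2B₀ ≤ M`, `c ∈ [M/2, M]`, a time `t ≥ 0` — at which
the pressure work on `{|u| > c}` is POSITIVE, and a common bound `K` for the space–time measure
and the level-set dissipation of `{|u| > c}` on every `[0, T')`. By the level-set energy identity
(route item `LevelSetEnergyInequality`) positivity of the work = an OVERSHOOT of the speed above
the initial maximum; on paper: at a flat maximum `x*` of `|u₀|²` (`∇u₀ = 0`, `Δ|u₀|² = 0` there)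
`∂ₜ|u|²(0,x*) = -2u₀·∇p̃₀(x*)`, odd under `u₀ ↦ -u₀`, so `±u₀` (small ⇒ global, decaying) overshoots.
Not constructible in the tree (no non-trivial global classical solution on `ℝ³` is). -/
def OvershootingGlobalSolution (ν : ℝ) (u : ℝ → ℝ³ → ℝ³) (p : ℝ → ℝ³ → ℝ)
    (E₀ B₀ M c t K : ℝ) : Prop :=
  (∀ T', 0 < T' → IsClassicalNSSolutionOn (Set.Ico 0 T') ν 0 u p) ∧
  (∀ T', 0 < T' → IsLerayHopfOn T' ν 0 (u 0) u) ∧ HasRapidSpatialDecay (u 0) ∧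
  (∫ x, ‖u 0 x‖ ^ 2) ≤ E₀ ∧ (∀ x, ‖u 0 x‖ ≤ B₀) ∧
  2 * B₀ ≤ M ∧ M / 2 ≤ c ∧ c ≤ M ∧ 0 < c ∧ 0 ≤ t ∧ 0 < pressureWork u c t ∧
  (∀ T', highSetMeasure u c T' ≤ K) ∧ (∀ T', speedDissipation u c T' ≤ K)

/-- `H_overshoot(ν)`: some overshooting global solution exists at viscosity `ν`. -/
def OvershootExists (ν : ℝ) : Prop :=
  ∃ (u : ℝ → ℝ³ → ℝ³) (p : ℝ → ℝ³ → ℝ) (E₀ B₀ M c t K : ℝ),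
    OvershootingGlobalSolution ν u p E₀ B₀ M c t K

/-- **Refutation of the data-uniform strengthening (modulo `H_overshoot`).** For `m < 4`, NO
constant modulus `F ≡ C` can work on any fibre `(ν, T)` once a single overshooting global solution
exists at viscosity `ν`: rescaling it by `l → ∞` keeps it admissible on `[0, T)` with data bounds
`(E₀/l, lB₀)` — invisible to a constant `F` — while the inequality acquires the factor
`l^{(m-4)/2} → 0` (`hspwWith_scaling`). So the data modulus `F(E₀, B₀)` of the crux is
load-bearing in an essential, `B₀`-sensitive way: any proof must let `F` grow at least like
`B₀^{4-m}` along scaling orbits. -/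
theorem not_hspwWith_const_of_overshoot {ν T m C : ℝ} (hT : 0 < T) (hm : m < 4)
    (hO : OvershootExists ν) : ¬ HSPWWith ν T m (fun _ _ => C) := by
  intro h
  obtain ⟨u, p, E₀, B₀, M, c, t, K, hcl, hLH, hdec, hE, hB, hM, hMc, hcM, hc, ht, hPW, hVK, hDK⟩ :=
    hO
  have hM0 : 0 ≤ M := le_trans hc.le hcM
  set Q : ℝ := Real.sqrt (|C| * M ^ m * K) * Real.sqrt K with hQ
  -- along `l → ∞`: eventually `0 < l`, `t < l² T` and `l^{(m-4)/2} Q < PW`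
  have ev1 : ∀ᶠ l : ℝ in atTop, 0 < l := eventually_gt_atTop 0
  have ev2 : ∀ᶠ l : ℝ in atTop, t < l ^ 2 * T :=
    ((tendsto_pow_atTop two_ne_zero).atTop_mul_const hT).eventually_gt_atTop t
  have hlim : Tendsto (fun l : ℝ => l ^ ((m - 4) / 2) * Q) atTop (𝓝 0) := by
    have e : (fun l : ℝ => l ^ ((m - 4) / 2) * Q) = fun l => l ^ (-((4 - m) / 2)) * Q := by
      funext l; congr 2; ring
    rw [e, ← zero_mul Q]
    exact (tendsto_rpow_neg_atTop (by linarith)).mul_const Q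
  have ev3 : ∀ᶠ l : ℝ in atTop, l ^ ((m - 4) / 2) * Q < pressureWork u c t :=
    hlim.eventually_lt_const hPW
  obtain ⟨l, hl, htl, hlt⟩ := (ev1.and (ev2.and ev3)).exists
  have key := hspwWith_scaling hT h hcl hLH hdec hE hB hM hMc hcM hc ht hl htl
  -- bound the data of the orbit by `K`
  have hbd : Real.sqrt (C * M ^ m * highSetMeasure u c (l ^ 2 * T)) *
      Real.sqrt (speedDissipation u c (l ^ 2 * T)) ≤ Q := by
    refine mul_le_mul (Real.sqrt_le_sqrt ?_) (Real.sqrt_le_sqrt (hDK _)) (Real.sqrt_nonneg _)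
      (Real.sqrt_nonneg _)
    calc C * M ^ m * highSetMeasure u c (l ^ 2 * T)
        ≤ |C| * M ^ m * highSetMeasure u c (l ^ 2 * T) :=
          mul_le_mul_of_nonneg_right (mul_le_mul_of_nonneg_right (le_abs_self C)
            (Real.rpow_nonneg hM0 _)) (highSetMeasure_nonneg _ _ _)
      _ ≤ |C| * M ^ m * K :=
          mul_le_mul_of_nonneg_left (hVK _) (mul_nonneg (abs_nonneg C) (Real.rpow_nonneg hM0 _))
  have : pressureWork u c t ≤ l ^ ((m - 4) / 2) * Q :=
    key.trans (mul_le_mul_of_nonneg_left hbd (Real.rpow_nonneg hl.le _))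
  linarith

/-- **Quantitative tightness of the modulus along a scaling orbit.** In the situation of
`OvershootingGlobalSolution` (bounds `K` on `V`, `D` along the orbit), any admissible modulus
satisfies `PW_c(t)² ≤ l^{m-4} · |F(E₀/l, lB₀)| · M^m · K²` for every `l > 0` with `t < l²T`, i.e.
`|F(E₀/l, l B₀)| ≥ l^{4-m} · PW_c(t)² / (M^m K²)`: at fixed `E₀B₀` the modulus grows at least like
`B₀^{4-m}` — for `m < 10/3` at least like `B₀^{2/3}`. -/
theorem modulus_lower_bound_of_overshoot {ν T m : ℝ} {F : ℝ → ℝ → ℝ} (hT : 0 < T)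
    (h : HSPWWith ν T m F) {u : ℝ → ℝ³ → ℝ³} {p : ℝ → ℝ³ → ℝ} {E₀ B₀ M c t K : ℝ}
    (hO : OvershootingGlobalSolution ν u p E₀ B₀ M c t K) (hl : 0 < l) (htl : t < l ^ 2 * T) :
    pressureWork u c t ^ 2 ≤ l ^ (m - 4) * (|F (E₀ / l) (l * B₀)| * M ^ m * K * K) := by
  obtain ⟨hcl, hLH, hdec, hE, hB, hM, hMc, hcM, hc, ht, hPW, hVK, hDK⟩ := hO
  have hM0 : 0 ≤ M := le_trans hc.le hcM
  have hK : 0 ≤ K := (highSetMeasure_nonneg u c 0).trans (hVK 0)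
  set a : ℝ := |F (E₀ / l) (l * B₀)| * M ^ m * K with ha
  have ha0 : 0 ≤ a := by rw [ha]; positivity
  have key := hspwWith_scaling hT h hcl hLH hdec hE hB hM hMc hcM hc ht hl htl
  have hbd : Real.sqrt (F (E₀ / l) (l * B₀) * M ^ m * highSetMeasure u c (l ^ 2 * T)) *
      Real.sqrt (speedDissipation u c (l ^ 2 * T)) ≤ Real.sqrt a * Real.sqrt K := by
    refine mul_le_mul (Real.sqrt_le_sqrt ?_) (Real.sqrt_le_sqrt (hDK _)) (Real.sqrt_nonneg _)
      (Real.sqrt_nonneg _)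
    calc F (E₀ / l) (l * B₀) * M ^ m * highSetMeasure u c (l ^ 2 * T)
        ≤ |F (E₀ / l) (l * B₀)| * M ^ m * highSetMeasure u c (l ^ 2 * T) :=
          mul_le_mul_of_nonneg_right (mul_le_mul_of_nonneg_right (le_abs_self _)
            (Real.rpow_nonneg hM0 _)) (highSetMeasure_nonneg _ _ _)
      _ ≤ |F (E₀ / l) (l * B₀)| * M ^ m * K :=
          mul_le_mul_of_nonneg_left (hVK _) (mul_nonneg (abs_nonneg _) (Real.rpow_nonneg hM0 _))
  have h1 : pressureWork u c t ≤ l ^ ((m - 4) / 2) * (Real.sqrt a * Real.sqrt K) :=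
    key.trans (mul_le_mul_of_nonneg_left hbd (Real.rpow_nonneg hl.le _))
  have h2 := pow_le_pow_left₀ hPW.le h1 2
  have e : (l ^ ((m - 4) / 2) * (Real.sqrt a * Real.sqrt K)) ^ 2 = l ^ (m - 4) * (a * K) := by
    rw [mul_pow, mul_pow, Real.sq_sqrt ha0, Real.sq_sqrt hK, ← Real.rpow_natCast,
      ← Real.rpow_mul hl.le]
    norm_num
  rw [e, ha] at h2
  linarith [h2]

/-- The crux-shaped DATA-UNIFORM strengthening: one constant per fibre `(ν, T)`. -/
def UniformHighSpeedPressureWork (m : ℝ) : Prop :=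
  ∀ (ν T : ℝ), 0 < ν → 0 < T → ∃ C : ℝ, HSPWWith ν T m (fun _ _ => C)

/-- **The uniform strengthening is false for every `m < 4` modulo one overshooting global
solution**: "`m < 10/3` with an absolute constant" is not a weaker true statement to aim for. -/
theorem not_uniformHighSpeedPressureWork {m : ℝ} (hm : m < 4)
    (hO : ∃ ν, 0 < ν ∧ OvershootExists ν) : ¬ UniformHighSpeedPressureWork m := by
  rintro h
  obtain ⟨ν, hν, hO⟩ := hO
  obtain ⟨C, hC⟩ := h ν 1 hν one_pos
  exact not_hspwWith_const_of_overshoot one_pos hm hO hC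

end Scaling

end Summit.NavierStokesRegularity.NavierStokesRegularity.Theorems.HighSpeedPressureWork.Negative

end
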